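import Mathlib.Analysis.Distribution.SchwartzSpace.Fourier
import Mathlib.Analysis.SpecialFunctions.Pow.Complex
import Mathlib.Analysis.SpecialFunctions.JapaneseBracket
import HarnessLib

/-!
# Local input for the smooth linear forms estimate (Conlon–Fox–Zhao §9): the Fourier step

Trunk T-SIEVE. D. Conlon, J. Fox, Y. Zhao, *The Green–Tao theorem: an exposition*
(arXiv:1403.2957), §9, p. 17: "Let `φ` be the Fourier transform of `e^x χ(x)` … Substituting and
simplifying, we have `χ(log d/log R) = ∫_ℝ d^{-(1+iξ)/log R} φ(ξ) dξ` … since `χ` is smooth and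
compactly supported, `φ` decays rapidly, that is, `φ(ξ) = O_A((1 + |ξ|)^{-A})` for any `A > 0`."

In Mathlib's normalisation (`𝓕 g (η) = ∫ g(x) e^{-2πi xη} dx`) the exponent is
`z(η) = (1 - 2πiη)/log R` (CFZ's `ξ = -2πη`). For a smooth `χ` vanishing on `|x| ≥ 1`:

* `expCutoff χ = e^x χ(x)` (complex-valued), `phiF χ = 𝓕 (expCutoff χ)`, `zOf R η = (1 - 2πiη)/log R`;
* `expCutoff_eq_fourierInv` (Fourier inversion, PROVED), `chi_eq_integral` (CFZ's displayed
  identity, PROVED), `norm_phiF_le` (rapid decay `|φ(η)| ≤ C_A (1+|η|)^{-A}`, PROVED),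
  `norm_natCast_cpow_neg_zOf` (`|d^{-z(η)}| = d^{-1/log R}`).

## References
* D. Conlon, J. Fox, Y. Zhao, EMS Surv. Math. Sci. 1 (2014), 249–282, §9 (p. 17).
  [cite: ConlonFoxZhao2014]
-/

noncomputable section

open MeasureTheory Real FourierTransform Complex
open scoped FourierTransform

namespace Literature.NumberTheory.Sieve.CFZ

/-- `g(x) = e^x χ(x)` as a complex-valued function. [cite: ConlonFoxZhao2014, Section 9] -/
def expCutoff (χ : ℝ → ℝ) (x : ℝ) : ℂ := ((Real.exp x * χ x : ℝ) : ℂ)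

/-- `φ = 𝓕 g`, the Fourier transform of `e^x χ(x)` (Mathlib normalisation).
[cite: ConlonFoxZhao2014, Section 9] -/
def phiF (χ : ℝ → ℝ) : ℝ → ℂ := 𝓕 (expCutoff χ)

/-- The exponent `z(η) = (1 - 2πiη)/log R` (CFZ's `z = (1 + iξ)/log R` with `ξ = -2πη`).
[cite: ConlonFoxZhao2014, Section 9] -/
def zOf (R η : ℝ) : ℂ := (1 - 2 * π * η * I) / (Real.log R : ℂ)

section Smooth

variable {χ : ℝ → ℝ}

/-- `g` is smooth. [cite: ConlonFoxZhao2014, Section 9] -/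
theorem expCutoff_contDiff (hs : ContDiff ℝ (⊤ : ℕ∞) χ) : ContDiff ℝ (⊤ : ℕ∞) (expCutoff χ) := by
  have h : ContDiff ℝ (⊤ : ℕ∞) fun x => Real.exp x * χ x := Real.contDiff_exp.mul hs
  exact (Complex.ofRealCLM.contDiff.of_le le_top).comp h

/-- `g` is supported in `[-1, 1]`. [cite: ConlonFoxZhao2014, Section 9] -/
theorem expCutoff_hasCompactSupport (hsupp : ∀ x, 1 ≤ |x| → χ x = 0) :
    HasCompactSupport (expCutoff χ) := by
  refine HasCompactSupport.intro (isCompact_Icc (a := (-1 : ℝ)) (b := 1)) fun x hx => ?_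
  have h1 : 1 ≤ |x| := by
    rw [Set.mem_Icc, not_and_or, not_le, not_le] at hx
    rcases hx with h | h
    · rw [abs_of_neg (by linarith)]; linarith
    · rw [abs_of_pos (by linarith)]; linarith
  simp [expCutoff, hsupp x h1]

variable (hs : ContDiff ℝ (⊤ : ℕ∞) χ) (hsupp : ∀ x, 1 ≤ |x| → χ x = 0)

/-- `g` as a Schwartz function. [cite: ConlonFoxZhao2014, Section 9] -/
def expCutoffS : SchwartzMap ℝ ℂ :=
  (expCutoff_hasCompactSupport hsupp).toSchwartzMap (expCutoff_contDiff hs)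

/-- Its underlying function is `g`. [cite: ConlonFoxZhao2014, Section 9] -/
@[simp] theorem expCutoffS_coe : ⇑(expCutoffS hs hsupp) = expCutoff χ := rfl

/-- `φ` as a Schwartz function: the Fourier transform of `expCutoffS`.
[cite: ConlonFoxZhao2014, Section 9] -/
def phiS : SchwartzMap ℝ ℂ := 𝓕 (expCutoffS hs hsupp)

/-- Its underlying function is `φ`. [cite: ConlonFoxZhao2014, Section 9] -/
@[simp] theorem phiS_coe : ⇑(phiS hs hsupp) = phiF χ := by
  rw [phiS, SchwartzMap.fourier_coe, expCutoffS_coe]; rfl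

include hs hsupp

/-- **Rapid decay of `φ`** ("`φ(ξ) = O_A((1+|ξ|)^{-A})`"): for every `A` there is `C` with
`|φ(η)| ≤ C (1 + |η|)^{-A}`. [cite: ConlonFoxZhao2014, Section 9] -/
theorem norm_phiF_le (A : ℕ) : ∃ C : ℝ, 0 ≤ C ∧ ∀ η : ℝ, ‖phiF χ η‖ ≤ C * ((1 + |η|) ^ A)⁻¹ := by
  set C := 2 ^ A * ((Finset.Iic (A, 0)).sup fun m => SchwartzMap.seminorm ℂ m.1 m.2) (phiS hs hsupp)
  refine ⟨C, by positivity, fun η => ?_⟩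
  have h := SchwartzMap.one_add_le_sup_seminorm_apply (𝕜 := ℂ) (m := (A, 0)) (k := A) (n := 0)
    le_rfl le_rfl (phiS hs hsupp) η
  rw [norm_iteratedFDeriv_zero, phiS_coe, Real.norm_eq_abs] at h
  have hpos : 0 < (1 + |η|) ^ A := by positivity
  rw [← div_eq_mul_inv, le_div_iff₀ hpos, mul_comm]
  exact h

/-- `φ` is integrable. [cite: ConlonFoxZhao2014, Section 9] -/
theorem phiF_integrable : Integrable (phiF χ) := by
  rw [← phiS_coe hs hsupp]; exact (phiS hs hsupp).integrable

/-- **Fourier inversion for `g`**: `e^x χ(x) = ∫ φ(η) e^{2πi ηx} dη`.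
[cite: ConlonFoxZhao2014, Section 9] -/
theorem expCutoff_eq_fourierInv (x : ℝ) :
    expCutoff χ x = ∫ η : ℝ, phiF χ η * Complex.exp (2 * π * (η * x) * I) := by
  have h : (𝓕⁻ (phiS hs hsupp) : SchwartzMap ℝ ℂ) = expCutoffS hs hsupp :=
    FourierTransform.fourierInv_fourier_eq _
  have h' := congrArg (fun f : SchwartzMap ℝ ℂ => (f : ℝ → ℂ) x) h
  simp only [SchwartzMap.fourierInv_coe, phiS_coe, expCutoffS_coe] at h'
  rw [← h', Real.fourierInv_eq']
  refine integral_congr_ae (Filter.Eventually.of_forall fun η => ?_)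
  simp only [RCLike.inner_apply, conj_trivial, smul_eq_mul]
  rw [mul_comm]
  congr 2
  push_cast
  ring

omit hs hsupp in
/-- `|d^{-z(η)}| = d^{-1/log R}` for `d ≥ 1`. [cite: ConlonFoxZhao2014, Section 9] -/
theorem norm_natCast_cpow_neg_zOf (R : ℝ) {d : ℕ} (hd : 1 ≤ d) (η : ℝ) :
    ‖(d : ℂ) ^ (-(zOf R η))‖ = (d : ℝ) ^ (-(1 / Real.log R)) := by
  rw [norm_natCast_cpow_of_pos (by omega)]
  congr 1
  simp [zOf, Complex.div_re, Complex.normSq]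

/-- **`χ(log d / log R) = ∫ φ(η) d^{-z(η)} dη`** for `d ≥ 1`, `R > 1` (CFZ p. 17, "Substituting
and simplifying"): evaluate the inversion formula at `x = log d/log R` and use
`e^{-x} e^{2πiηx} = d^{-(1-2πiη)/log R}`. [cite: ConlonFoxZhao2014, Section 9] -/
theorem chi_eq_integral {R : ℝ} (hR : 1 < R) {d : ℕ} (hd : 1 ≤ d) :
    ((χ (Real.log d / Real.log R) : ℝ) : ℂ) = ∫ η : ℝ, phiF χ η * (d : ℂ) ^ (-(zOf R η)) := by
  have hlogR : 0 < Real.log R := Real.log_pos hR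
  have hd0 : (0 : ℝ) < d := by exact_mod_cast hd
  set x := Real.log d / Real.log R with hx
  -- `χ(x) = e^{-x} g(x)`
  have h1 : ((χ x : ℝ) : ℂ) = Complex.exp (-x) * expCutoff χ x := by
    simp only [expCutoff]
    push_cast
    rw [← mul_assoc, ← Complex.ofReal_neg, ← Complex.ofReal_exp, ← Complex.ofReal_exp,
      ← Complex.ofReal_mul, ← Real.exp_add, neg_add_cancel, Real.exp_zero]
    simp
  rw [h1, expCutoff_eq_fourierInv hs hsupp x, ← integral_const_mul]
  refine integral_congr_ae (Filter.Eventually.of_forall fun η => ?_)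
  -- `e^{-x} e^{2πiηx} = d^{-z(η)}`
  have hdC : (d : ℂ) ≠ 0 := by exact_mod_cast (by omega : d ≠ 0)
  show Complex.exp (-x) * (phiF χ η * Complex.exp (2 * π * (η * x) * I)) = phiF χ η * (d : ℂ) ^ (-(zOf R η))
  rw [mul_left_comm, cpow_def_of_ne_zero hdC, ← Complex.exp_add]
  congr 2
  have hL : (Real.log R : ℂ) ≠ 0 := by exact_mod_cast hlogR.ne'
  have hxC : (x : ℂ) = Complex.log (d : ℂ) / (Real.log R : ℂ) := by
    rw [hx, Complex.ofReal_div, Complex.natCast_log]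
  rw [hxC]
  simp only [zOf]
  field_simp
  ring

end Smooth

end Literature.NumberTheory.Sieve.CFZ
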